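import Literature.AlgebraicGeometry.Hu2025.Statements.S08MainTheorem.R110dEllTransform
import HarnessLib

/-!
# Glue for J1 readers: `IsIntegral (gammaSpec 𝔉 Γ) ↔ IsDomain (GammaSchemeRing 𝔉 Γ)` (row 110 file d's `Z_Γ` as a scheme vs
# row 109's coordinate ring). res-type-024 gen 11; kernel support, nothing of [Hu25] asserted.
-/

namespace Literature.AlgebraicGeometry.Hu2025.Statements.S08MainTheorem

open _root_.AlgebraicGeometry Literature.AlgebraicGeometry.Hu2025.Statements.S07GammaSchemes

universe u

/-- **`Z_Γ` is integral iff its coordinate ring `𝔽[x]/I_{℘,Γ}` is a domain** (Mathlib `affine_isIntegral_iff`) — the glue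
between file d's scheme-level `IsIntegral (gammaSpec 𝔉 Γ)` (hypothesis of `Thm8_5`/`Thm8_6`/`Thm1_3`, conclusion of
`Hu22P131L40`) and ring-level statements about row 109's `GammaSchemeRing 𝔉 Γ` (e.g. res-type-009's / res-type-016's kernel
notes). [cite: Hu2025, Def. 7.1 chunk p0057 l.19–23 and Thm 8.5 chunk p0070 l.78 (unrefereed preprint arXiv:2507.21400v1 under
adjudication, D-0012/D-0089 — kernel support on OUR typed carriers of rows 109/110; nothing of the source asserted)] -/
theorem isIntegral_gammaSpec_iff {σ 𝔽 : Type u} [Field 𝔽] (𝔉 : Set (MvPolynomial σ 𝔽)) (Γ : Set σ) :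
    IsIntegral (gammaSpec 𝔉 Γ) ↔ IsDomain (GammaSchemeRing 𝔉 Γ) :=
  affine_isIntegral_iff (CommRingCat.of (GammaSchemeRing 𝔉 Γ))

/-- **… equivalently, row 109's named hypothesis `ZGammaIntegral 𝔉 Γ`** (res-type-016's I-GA v016: `ZGammaIntegral 𝔉 Γ :=
IsDomain (GammaSchemeRing 𝔉 Γ)`): file d's scheme-level `IsIntegral (gammaSpec 𝔉 Γ)` ↔ `ZGammaIntegral 𝔉 Γ`.
[cite: Hu2025, Thm 8.5 chunk p0070 l.78 «Assume that Z_Γ is integral» (unrefereed preprint arXiv:2507.21400v1 under adjudication,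
D-0012/D-0089 — kernel glue between OUR typed carriers of rows 109/110; nothing of the source asserted)] -/
theorem isIntegral_gammaSpec_iff_zGammaIntegral {σ 𝔽 : Type u} [Field 𝔽] (𝔉 : Set (MvPolynomial σ 𝔽)) (Γ : Set σ) :
    IsIntegral (gammaSpec 𝔉 Γ) ↔ ZGammaIntegral 𝔉 Γ :=
  isIntegral_gammaSpec_iff 𝔉 Γ

end Literature.AlgebraicGeometry.Hu2025.Statements.S08MainTheorem
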